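import Summits.RiemannHypothesis.RiemannHypothesis.Theorems.WeilColumnThetaCut
import Summits.RiemannHypothesis.RiemannHypothesis.Theorems.WeilColumnBSplineProfileCDF
import HarnessLib

/-!
# THETA kernel certificate, D4 for the witness, part 1: the TOP LAYER of `Θ`, `G₀` and `g` in the interface's names (RH-FREE)

Cell `rh-explicit`, WEIL column, seat weil-1 gen19 (THETA-ASSIGN v1.0/1.1 §3 item D4 «one-atom decomposition»; THETA-CERT-cc6
§D4/§D8). handoff-prove-2's `WeilColumnBSplineProfileCDF` gives the profile in CDF form, its sup bound and its top layer
`h(c₂ − ετ) = 1 − F(1 − τ)`; this file transports them to the WITNESS of an admissible row `P : ThetaParams` (`WeilColumnThetaWitness`):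

* `norm_h_le_hmax : ‖P.h y‖ ≤ P.hmax`; `h_eq_Rtop : P.h y = P.Rtop ((c₂ − y)/ε)` on the top zone `y ≥ m₀ + ε` (which contains
  `[c₂ − ε, c₂]`: `m₀_add_eps_le`), hence **`h_c₂_mul_exp_neg : P.h (c₂e^{−w}) = P.Rtop (P.τ₁ w)`** for `w ≤ 2δ`;
* `Θ_eq_G : P.Θ u = P.G u` for `u > λc₂/2` (one theta term; `e^{2δ} < 2` puts `e^{a−2δ}` above `λc₂/2`: `lam_mul_c₂_half_lt`);
* **`G₀_top : P.G₀ x = e^{x/2}·P.Rtop (P.τ₁ (a − x))`** and, for `q ≥ 2` (so that the cut is `1` there: `eta_le_log_q`),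
  **`g_top : P.g x = e^{x/2}·P.Rtop (P.τ₁ (a − x))`** for `x ≥ a − 2δ` — the hypothesis `htop` of handoff-prove-2's abstract
  `ThetaAtom.norm_atom_sub_le` / `integral_top_eq` with `ρ = Rtop ∘ τ₁`; `log_q_eq : log q = 2a − 2δ`.

The instantiation of the abstract one-atom decomposition follows in `WeilColumnThetaAtomWitness`.
Upper-clause bookkeeping only; nothing here bears on the truth of RH.
-/

noncomputable section

set_option linter.dupNamespace false

open Complex Set MeasureTheory Filter
open scoped Real Topology

namespace Summit.RiemannHypothesis.RiemannHypothesis.Theorems.WeilColumn.ThetaMellin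

open Literature.NumberTheory.LFunctions ThetaParams

namespace ThetaParams

variable {P : ThetaParams}

/-! ## §1 The profile of an admissible row: sup bound and top zone -/

/-- `1 ≤ m` for an admissible row. -/
private theorem one_le_m' {qn : ℕ} (hP : P.Admissible qn) : 1 ≤ P.m := le_trans (by norm_num) hP.three_le

/-- `2 ≤ m` for an admissible row. -/
private theorem two_le_m' {qn : ℕ} (hP : P.Admissible qn) : 2 ≤ P.m := le_trans (by norm_num) hP.three_le

/-- `0 < ε` for an admissible row. -/
private theorem eps_pos {qn : ℕ} (hP : P.Admissible qn) : 0 < P.ε := by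
  have := hP.delta_pos; have := hP.c₂_pos; unfold ε; positivity

/-- `0 < λ` for an admissible row. -/
private theorem lam_pos {qn : ℕ} (hP : P.Admissible qn) : 0 < P.lam := by
  have := hP.c₂_pos; unfold lam; positivity

/-- `0 ≤ α` for an admissible row. -/
private theorem alpha_nonneg {qn : ℕ} (hP : P.Admissible qn) : 0 ≤ P.α :=
  div_nonneg (by linarith [hP.seed₂]) (by linarith [hP.seed₁])

/-- `‖h(y)‖ ≤ h_max = max 1 α` for an admissible row (`norm_profile_le`). [folklore] -/
theorem norm_h_le_hmax {qn : ℕ} (hP : P.Admissible qn) (y : ℝ) : ‖P.h y‖ ≤ P.hmax :=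
  norm_profile_le (two_le_m' hP) (eps_pos hP) hP.seed₂.le hP.seed₁.le (alpha_nonneg hP) y

/-- **Top zone in Irwin–Hall currency**: for `y ≥ m₀ + ε`, `P.h y = P.Rtop ((c₂ − y)/ε)`
(`Rtop τ = 1 − bsplineCDF (1/m) (m−1) (1 − τ)`; `profile_top_eq` at `τ = (c₂ − y)/ε`). [folklore] -/
theorem h_eq_Rtop {qn : ℕ} (hP : P.Admissible qn) {y : ℝ} (hy : P.m₀ + P.ε ≤ y) :
    P.h y = ((P.Rtop ((P.c₂ - y) / P.ε) : ℝ) : ℂ) := by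
  have hε := eps_pos hP
  set τ := (P.c₂ - y) / P.ε with hτ
  have hyτ : P.c₂ - P.ε * τ = y := by rw [hτ]; field_simp; ring
  have h := profile_top_eq (α := P.α) (two_le_m' hP) hε hP.seed₂.le hP.seed₁.le (τ := τ) (by rw [hyτ]; exact hy)
  rw [hyτ] at h
  show profile P.c₁ P.m₀ P.c₂ P.ε P.α P.m y = _
  rw [h]
  rfl

/-- The top zone contains `[c₂ − ε, ∞)`: `m₀ + ε ≤ c₂ − ε` (indeed `m₀ + ε < c₂ − 3ε`). [folklore] -/
theorem m₀_add_eps_le {qn : ℕ} (hP : P.Admissible qn) : P.m₀ + P.ε ≤ P.c₂ - P.ε := by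
  have := hP.eps_small₂; have := hP.seed₂; linarith

/-- **`h(c₂e^{−w}) = Rtop(τ₁(w))`** for `w ≤ 2δ` (`τ₁ w = (1 − e^{−w})/(2δ)`; `c₂e^{−2δ} ≥ c₂(1 − 2δ) = c₂ − ε ≥ m₀ + ε`).
[THETA-CERT-cc6 §D8 (top-layer profile)] -/
theorem h_c₂_mul_exp_neg {qn : ℕ} (hP : P.Admissible qn) {w : ℝ} (hw : w ≤ 2 * P.δ) :
    P.h (P.c₂ * Real.exp (-w)) = ((P.Rtop (P.τ₁ w) : ℝ) : ℂ) := by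
  have hc₂ := hP.c₂_pos
  have hδ := hP.delta_pos
  have hy : P.m₀ + P.ε ≤ P.c₂ * Real.exp (-w) := by
    have h1 : 1 - 2 * P.δ ≤ Real.exp (-w) := by
      have := Real.add_one_le_exp (-w); linarith
    have h2 : P.c₂ * (1 - 2 * P.δ) ≤ P.c₂ * Real.exp (-w) := mul_le_mul_of_nonneg_left h1 hc₂.le
    have h3 : P.c₂ * (1 - 2 * P.δ) = P.c₂ - P.ε := by unfold ε; ring
    linarith [m₀_add_eps_le hP]
  rw [h_eq_Rtop hP hy]
  congr 2
  unfold τ₁ ε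
  field_simp

/-! ## §2 The top layer of `Θ`, `G₀`, `g` -/

/-- **One theta term above `λc₂/2`**: `Θ(u) = G(u)` for `u > λc₂/2` (the terms `n ≥ 2` see `nu ≥ 2u > λc₂`). [folklore] -/
theorem Θ_eq_G {qn : ℕ} (hP : P.Admissible qn) {u : ℝ} (hu : P.lam * P.c₂ / 2 < u) : P.Θ u = P.G u := by
  have hm : 1 ≤ P.m := one_le_m' hP
  have hε : 0 ≤ P.ε := (eps_pos hP).le
  have hlam := lam_pos hP
  show thetaSum P.G u = P.G u
  rw [thetaSum, tsum_eq_single 0]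
  · simp
  · intro n hn
    refine Function.notMem_support.mp fun hmem ↦ ?_
    have hsub := support_profile_subset (α := P.α) hm hε hP.seed₂.le hP.seed₁.le hmem
    have h2 : (2 : ℝ) ≤ ((n + 1 : ℕ) : ℝ) := by exact_mod_cast (by omega : 2 ≤ n + 1)
    have hu0 : 0 < u := lt_trans (by have := hP.c₂_pos; positivity) hu
    have : P.c₂ < ((n + 1 : ℕ) : ℝ) * u / P.lam := by
      rw [lt_div_iff₀ hlam]; nlinarith
    exact absurd hsub.2 (not_le.2 this)

/-- `e^{a − 2δ} > λc₂/2` (as `λc₂ = eᵃ` and `e^{2δ} < 2`). [folklore] -/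
theorem lam_mul_c₂_half_lt {qn : ℕ} (hP : P.Admissible qn) : P.lam * P.c₂ / 2 < Real.exp (P.a - 2 * P.δ) := by
  have hlc : P.lam * P.c₂ = Real.exp P.a := by have := hP.c₂_pos.ne'; unfold lam; field_simp
  rw [hlc, Real.exp_sub, lt_div_iff₀ (Real.exp_pos _)]
  have := hP.exp_lt_two
  nlinarith [Real.exp_pos P.a]

/-- **The top layer of `G₀`**: for `x ≥ a − 2δ`, `G₀(x) = e^{x/2}·Rtop(τ₁(a − x))` (for `x > a` both sides vanish). [THETA-CERT-cc6 §D4/§D8] -/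
theorem G₀_top {qn : ℕ} (hP : P.Admissible qn) {x : ℝ} (hx1 : P.a - 2 * P.δ ≤ x) :
    P.G₀ x = (Real.exp (x / 2) : ℂ) * ((P.Rtop (P.τ₁ (P.a - x)) : ℝ) : ℂ) := by
  have hc₂ := hP.c₂_pos
  have hΘ : P.Θ (Real.exp x) = P.G (Real.exp x) :=
    Θ_eq_G hP (lt_of_lt_of_le (lam_mul_c₂_half_lt hP) (Real.exp_le_exp.2 hx1))
  have hG : P.G (Real.exp x) = P.h (P.c₂ * Real.exp (-(P.a - x))) := by
    show P.h (Real.exp x / P.lam) = _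
    congr 1
    unfold lam
    rw [show -(P.a - x) = x - P.a by ring, Real.exp_sub]
    field_simp
  show (Real.exp (x / 2) : ℂ) * P.Θ (Real.exp x) = _
  rw [hΘ, hG, h_c₂_mul_exp_neg hP (by linarith)]

/-- `η ≤ log q` when `q ≥ 2` (`η < a = (log q)/2 + δ` and `2δ < log 2 ≤ log q`). [folklore] -/
theorem eta_le_log_q {qn : ℕ} (hP : P.Admissible qn) (hq : 2 ≤ P.q) : P.η ≤ Real.log P.q := by
  have h1 := hP.eta_lt
  have h2 : 2 * P.δ < Real.log 2 := by
    have h := hP.exp_lt_two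
    have := Real.log_lt_log (Real.exp_pos _) h
    rwa [Real.log_exp] at this
  have h3 : Real.log 2 ≤ Real.log P.q := Real.log_le_log (by norm_num) (by exact_mod_cast hq)
  unfold a at h1
  linarith

/-- On the top layer the cut is invisible (`a − 2δ ≥ x₁` when `q ≥ 2`): `g(x) = G₀(x)` for `x ≥ a − 2δ`. [folklore] -/
theorem g_eq_G₀_top {qn : ℕ} (hP : P.Admissible qn) (hq : 2 ≤ P.q) {x : ℝ} (hx1 : P.a - 2 * P.δ ≤ x) : P.g x = P.G₀ x := by
  have hx₁ : P.x₁ ≤ x := by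
    have := eta_le_log_q hP hq
    unfold x₁; unfold a at hx1 ⊢; linarith
  rw [g, P.cut_eq_one hP.eta_pos (one_le_m' hP) hx₁]
  simp

/-- **The top layer of `g`** (`q ≥ 2`): for `x ≥ a − 2δ`, `g(x) = e^{x/2}·Rtop(τ₁(a − x))` (a real number) — the hypothesis
`htop` of `ThetaAtom.integral_top_eq` / `norm_atom_sub_le` with `ρ = Rtop ∘ τ₁`. [THETA-CERT-cc6 §D4] -/
theorem g_top {qn : ℕ} (hP : P.Admissible qn) (hq : 2 ≤ P.q) {x : ℝ} (hx1 : P.a - 2 * P.δ ≤ x) :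
    P.g x = ((Real.exp (x / 2) * P.Rtop (P.τ₁ (P.a - x)) : ℝ) : ℂ) := by
  rw [g_eq_G₀_top hP hq hx1, G₀_top hP hx1]; push_cast; ring

/-- `log q = 2a − 2δ`. [folklore] -/
theorem log_q_eq (P : ThetaParams) : Real.log P.q = 2 * P.a - 2 * P.δ := by unfold a; ring

end ThetaParams

end Summit.RiemannHypothesis.RiemannHypothesis.Theorems.WeilColumn.ThetaMellin

end
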